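import Literature.NumberTheory.LFunctions.CertifiedLFunctionFourierTheta
import HarnessLib

/-!
# The truncation error of Platt's theta series: Booker 2006, Lemmas 5.2 and 5.4 (journal numbering) for degree one

Topic `Literature/NumberTheory/LFunctions`; namespace `Literature.NumberTheory.LFunctions`, engine
sub-namespace `ThetaTruncation`. Everything here is PROVED (no named fact, no definition). Typed for the
parity-realchar cell (D-0088 (4) literature-typing layer, row «Platt 2016 / Booker 2006»): instrument
provenance for Platt's "Algorithm 2" (Math. Comp. 85 (2016) §7 = Booker's rigorous FFT method
specialised to Dirichlet `L`-functions). Lemmas 7.1–7.2 (`platt2016_lemma71_72`,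
`CertifiedLFunctionFourierTheta.lean`) give `F̂_e`, `F̂_o` as theta series; Platt (p. 3018): "we can
now truncate the sum, bounding the error either by reference to Lemma 5.4 of [3] [Booker 2006] or by
majorising the missing terms with the obvious geometric series" — no bound is displayed there. Platt's
"Lemma 5.4 of [3]" is, in the JOURNAL numbering of Booker's paper (Experiment. Math. 15 (2006), §5.3
"Asymptotics", p. 401), exactly the truncation lemma: Lemma 5.4 there bounds the tail `Σ_{n>M}` of the
coefficient series for `F̂`, and it rests on Lemma 5.2 (p. 401; the size of the kernel
`G(u; η, {μ_j})`), both stated for `L`-functions of any degree `r`.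
This file proves their DEGREE-ONE cases (`r = 1`, one real parameter `μ₁ = a`; Dirichlet: `a = a_χ ∈
{0,1}`, `N = q`, `a_n = χ(n)`) and Platt's truncation statement that follows.

Degree-one dictionary (Booker §5.1–5.3, arXiv:math/0507502 §5): `Γ_ℝ(s) = π^{-s/2}Γ(s/2)`,
`γ(s) = ε N^{(s-1/2)/2} Γ_ℝ(s + a)`, `F(t) = Λ(1/2+it) e^{(π/4)ηt}` (`|η| < 1`),
`F̂(x) = ε Σ_{n≥1} (a_n/√n) G(x + log(n/√N))` (entire case) with the kernel
`G(u) = (1/2πi) ∫_{(2)} e^{(u+iπη/4)(1/2-s)} Γ_ℝ(s+a) ds = 2 e^{(1/2+a)(u+iπη/4)} exp(-π e^{2(u+iπη/4)})`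
— the Cahen–Mellin evaluation, exact for `r = 1` (Booker, §5.3: "For `r = 1` the formula is exact");
with `N = q`, `a_n = χ(n)` the `n`-th term `ε (a_n/√n) G(x + log(n/√q))` is literally the `n`-th term
`2ε e^{(1/2+a)u(x)} q^{-(1/2+a)/2} · n^a χ(n) exp(-πn²e^{2u(x)}/q)` of `platt2016_lemma71_72`
(`u(x) = x + iπη/4`). Booker's constants for `r = 1`: `δ = (π/2)(1-|η|)`, `ν₁ = a/2`, `μ = 1/2 + a`,
`K = 4/√δ`, `X = πδe^{-δ}e^{2u}` (Lemma 5.2) resp. `X = πδe^{-δ}(e^x/√N)²` (Lemma 5.4).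

NUMBERING (journal, read first-hand 2026-08-28 on the Project Euclid open-access pdf of Experiment. Math.
15 (2006) no. 4, pp. 385–407; arXiv:math/0507502 numbers lemmas globally and leaves remarks unnumbered,
the journal numbers lemmas AND remarks within sections): §5.1 Lemma 5.1 (p. 399) = arXiv Lemma 9;
§5.3 Lemma 5.2 (p. 401, the `G`-bound (5–12)) = arXiv Lemma 10; Remark 5.3 (p. 401, "within a factor
`O(δ^{-1/2})`"); Lemma 5.4 (p. 401, the tail `Σ_{n>M}`: "Let `δ, ν_j, μ, K` be as in Lemma 5.2") = arXiv
Lemma 11; Remark 5.5 (p. 401, the choice of `C, α`); Lemma 5.6 (p. 402, "let notation be as in Lemma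
5.4") = arXiv Lemma 12 = Platt's Lemma 7.4; Lemma 5.7 (p. 402) = arXiv Lemma 13 (§4 likewise: Lemma 4.1,
Remark 4.2, Lemmas 4.3–4.5, Theorem 4.6, Remark 4.7 = arXiv 4, –, 5, 6, 7, 8, –). ERRATUM OF RECORD for
this file's first version (2026-08-27, typed from the arXiv source): it labelled the `G`-bound "Lemma
5.4" (decl `booker2006_lemma54_degreeOne`) and the tail lemma "Lemma 5.5" (decl
`booker2006_lemma55_degreeOne`), inferring consecutive journal numbers from the arXiv order; the journal
pages show `G`-bound = Lemma 5.2 and tail = Lemma 5.4. The two theorems are RENAMED accordingly below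
(`booker2006_lemma52_degreeOne` = the `G`-bound, `booker2006_lemma54_degreeOne` = the tail lemma;
statements and proofs unchanged; no other module referred to the old names), so that the name
`booker2006_lemma54_degreeOne` now denotes journal Lemma 5.4, the lemma Platt cites.

## Contents (all proved)

* `booker2006_lemma52_degreeOne` — **Lemma 5.2 (p. 401), `r = 1`:** `|G(u)| ≤ K e^{(1/2+a)u} e^{-X} (1 + a/(2X))^{a/2}`
  (the closed-form `G`; in fact `|G(u)| = 2e^{(1/2+a)u}exp(-πe^{2u}cos(πη/2)) ≤ 2e^{(1/2+a)u}e^{-X}`,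
  `ThetaTruncation.norm_G_le`, because `cos(πη/2) = sin δ ≥ δe^{-δ}`).
* `booker2006_lemma54_degreeOne` — **Lemma 5.4 (p. 401), `r = 1`, bounded coefficients (`α = 0`):** for
  `|a_n| ≤ C`, `M ≥ 1`, `XM² > 1`:
  `|Σ_{n>M} (a_n/√n) G(x + log(n/√N))| ≤ (K/2)(e^x/√N)^{1/2+a} · C M^{1+a} e^{-XM²}/(XM²) · (1 + a/(2XM²))^{a/2}`
  (+ convergence). `-- TODO(general form): |a_n| ≤ Cn^α with α > 0, and degree r > 1, not typed.`
* `ThetaTruncation.tail_norm_le` — the same tail bounded by `C (e^x/√N)^{1/2+a} M^{1+a}e^{-XM²}/(XM²)`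
  under `2XM² ≥ 1` (the direct Gaussian-tail majorisation; Booker's extra factor is `≥ 1`).
* `platt2016_theta_truncation` — **Platt's truncation (p. 3018) made explicit:** for `χ` primitive
  mod `q > 1`, `|η| < 1`, `M ≥ 1` with `2XM² ≥ 1`, `X = πδe^{-δ}e^{2x}/q`:
  `|F̂(x) - 2εe^{(1/2+a)u}q^{-(1/2+a)/2} Σ_{n≤M} n^a χ(n) e^{-πn²e^{2u}/q}| ≤ |2εe^{(1/2+a)u}q^{-(1/2+a)/2}| · e^{-XM²}/(2XM^{1-a})`,
  i.e. `≤ |ε| (e^x/√q)^{1/2+a} M^{1+a} e^{-XM²}/(XM²)`, Booker's Lemma 5.4 bound with `C = 1` and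
  without the factor `(K/2)(1 + a/(2XM²))^{a/2}`.
* Engine (`ThetaTruncation.*`, [folklore]): `δe^{-δ} ≤ sin δ` (`0 < δ ≤ 2`), `cos(πη/2) = sin δ`,
  `|G|` in closed form, `∫_m^∞ te^{-Xt²} dt = e^{-Xm²}/(2X)`, monotonicity of `te^{-Xt²}` past
  `t² ≥ 1/(2X)`, and the integer tails `Σ_{n>M} n e^{-Xn²} ≤ e^{-XM²}/(2X)`,
  `Σ_{n>M} n^a e^{-Xn²} ≤ e^{-XM²}/(2XM^{1-a})` (`a ≤ 1`) by the sum–integral comparison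
  (Mathlib's `AntitoneOn.sum_le_integral`) — the step "the terms are monotonically decreasing; thus we
  can estimate by the integral" of Booker's proof of Lemma 5.4.

Remarks. (i) Booker's printed proof of Lemma 5.4 needs the terms `n^{c-1}e^{-Xn^{2/r}}` decreasing
for `n ≥ M`, i.e. `2XM² ≥ c - 1 = a` here — implied by `XM² > 1`; the weaker `2XM² ≥ 1` suffices for
the route used (`n^a ≤ n/M^{1-a}`, then the tail of `ne^{-Xn²}`), hence the hypothesis of
`tail_norm_le` / `platt2016_theta_truncation`. (ii) `K = 4/√δ > 2` since `δ ≤ π/2 < 4`; the printed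
hypothesis `X ≥ r` of Lemma 5.2 is not needed when `r = 1` and is kept as an unused binder.
(iii) Nothing here is specific to primitive characters except Platt's identity `platt2016_lemma71_72`
used in `platt2016_theta_truncation`.

## References

* A. R. Booker, *Artin's conjecture, Turing's method, and the Riemann hypothesis*, Experiment. Math.
  **15** (2006) no. 4, 385–407 (Project Euclid open access; pp. 399–402 read), §5.1 (the set-up `γ`,
  `F`, `F̂`, `G`), §5.3 p. 401: Lemma 5.2, Remark 5.3, Lemma 5.4, Remark 5.5, with proofs
  (arXiv:math/0507502: Lemmas 10–11 and the two unnumbered remarks). [Booker2006]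
* D. J. Platt, *Numerical computations concerning the GRH*, Math. Comp. **85** (2016) 3009–3027, §7.1
  p. 3018 (the truncation remark after Lemmas 7.1–7.2; arXiv:1305.3087v1 §5). [Platt2016GRH]
-/

noncomputable section

open Complex Filter Topology Set MeasureTheory
open scoped Real Nat

namespace Literature.NumberTheory.LFunctions

namespace ThetaTruncation

/-- `δ e^{-δ} ≤ sin δ` for `0 < δ ≤ 2` (via `sin δ > δ - δ³/6 ≥ δ/(1+δ) ≥ δ e^{-δ}`). [folklore] -/
private theorem mul_exp_neg_le_sin {δ : ℝ} (h0 : 0 < δ) (h2 : δ ≤ 2) :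
    δ * Real.exp (-δ) ≤ Real.sin δ := by
  have h1 : Real.exp (-δ) ≤ 1 / (δ + 1) := by
    rw [Real.exp_neg, ← one_div]
    exact one_div_le_one_div_of_le (by positivity) (Real.add_one_le_exp δ)
  have h3 : δ * (1 / (δ + 1)) ≤ δ - δ ^ 3 / 6 := by
    rw [mul_one_div, div_le_iff₀ (by positivity)]
    nlinarith [mul_pos h0 h0, mul_nonneg h0.le (mul_nonneg h0.le h0.le)]
  calc δ * Real.exp (-δ) ≤ δ * (1 / (δ + 1)) := mul_le_mul_of_nonneg_left h1 h0.le
    _ ≤ δ - δ ^ 3 / 6 := h3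
    _ ≤ Real.sin δ := (Real.sin_gt_sub_cube h0).le

/-- `cos(πη/2) = sin(π(1-|η|)/2)`. [folklore] -/
private theorem cos_eq_sin_delta (η : ℝ) : Real.cos (π * η / 2) = Real.sin (π / 2 * (1 - |η|)) := by
  rw [show π / 2 * (1 - |η|) = π / 2 - π * |η| / 2 by ring, Real.sin_pi_div_two_sub,
    show π * |η| / 2 = |π * η / 2| by
      rw [abs_div, abs_mul, abs_of_pos Real.pi_pos, abs_of_pos (by norm_num : (0:ℝ) < 2)],
    Real.cos_abs]

/-- With `δ = π(1-|η|)/2`, `|η| < 1`: `δ e^{-δ} ≤ cos(πη/2)` (Booker's sector constant for `r = 1`: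
`|exp(-π e^{2(u+iπη/4)})| = exp(-π e^{2u} cos(πη/2)) ≤ exp(-π δ e^{-δ} e^{2u})`). [folklore] -/
private theorem delta_mul_exp_le_cos {η δ : ℝ} (hη : |η| < 1) (hδ : δ = π / 2 * (1 - |η|)) :
    δ * Real.exp (-δ) ≤ Real.cos (π * η / 2) := by
  rw [cos_eq_sin_delta, ← hδ]
  have h0 : 0 < δ := by rw [hδ]; nlinarith [Real.pi_pos, abs_nonneg η]
  have h2 : δ ≤ 2 := by rw [hδ]; nlinarith [Real.pi_lt_four, abs_nonneg η]
  exact mul_exp_neg_le_sin h0 h2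

/-- `δ = π(1-|η|)/2 > 0` for `|η| < 1`. [folklore] -/
private theorem delta_pos {η δ : ℝ} (hη : |η| < 1) (hδ : δ = π / 2 * (1 - |η|)) : 0 < δ := by
  rw [hδ]; nlinarith [Real.pi_pos, abs_nonneg η]

/-- `δ = π(1-|η|)/2 ≤ π/2`. [folklore] -/
private theorem delta_le {η δ : ℝ} (hδ : δ = π / 2 * (1 - |η|)) : δ ≤ π / 2 := by
  rw [hδ]; nlinarith [Real.pi_pos, abs_nonneg η]

/-- The modulus of Booker's kernel for `r = 1`,
`G(v) = 2 e^{(1/2+a)(v+iπη/4)} exp(-π e^{2(v+iπη/4)})`: `|G(v)| = 2 e^{(1/2+a)v} exp(-π e^{2v} cos(πη/2))`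
(the exact size the stationary-phase formula of §5.3 describes for `r = 1`).
[cite: Booker2006, §5.3 p. 401, before Lemma 5.2 ("for r = 1 the formula is exact")] -/
theorem norm_G_eq (a v η : ℝ) :
    ‖(2 : ℂ) * cexp ((1 / 2 + a) * (v + π * η * I / 4)) * cexp (-(π * cexp (2 * (v + π * η * I / 4))))‖
      = 2 * Real.exp ((1 / 2 + a) * v) * Real.exp (-(π * (Real.exp (2 * v) * Real.cos (π * η / 2)))) := by
  have e1 : ((1 : ℂ) / 2 + a) * (v + π * η * I / 4) =
      (((1 / 2 + a) * v : ℝ) : ℂ) + (((1 / 2 + a) * (π * η / 4) : ℝ) : ℂ) * I := by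
    push_cast; ring
  have e2 : (2 : ℂ) * (v + π * η * I / 4) = ((2 * v : ℝ) : ℂ) + ((π * η / 2 : ℝ) : ℂ) * I := by
    push_cast; ring
  rw [norm_mul, norm_mul, Complex.norm_two, Complex.norm_exp, Complex.norm_exp, e1, e2]
  congr 2
  · simp
  · rw [Complex.neg_re, re_ofReal_mul, Complex.exp_re]
    simp

/-- **Booker's Lemma 5.2 for `r = 1`, sharp form:** with `δ = π(1-|η|)/2` and
`X = π δ e^{-δ} e^{2v}`, `|G(v)| ≤ 2 e^{(1/2+a)v} e^{-X}` (Lemma 5.2's bound for `r = 1` with the constant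
`2` in place of `K (1 + a/(2X))^{a/2} ≥ 2`). [cite: Booker2006, §5.3 Lemma 5.2 p. 401 (r = 1) and proof] -/
theorem norm_G_le {a v η δ X : ℝ} (hη : |η| < 1) (hδ : δ = π / 2 * (1 - |η|))
    (hX : X = π * δ * Real.exp (-δ) * Real.exp (2 * v)) :
    ‖(2 : ℂ) * cexp ((1 / 2 + a) * (v + π * η * I / 4)) * cexp (-(π * cexp (2 * (v + π * η * I / 4))))‖
      ≤ 2 * Real.exp ((1 / 2 + a) * v) * Real.exp (-X) := by
  rw [norm_G_eq]
  have hc := delta_mul_exp_le_cos hη hδ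
  have : X ≤ π * (Real.exp (2 * v) * Real.cos (π * η / 2)) := by
    rw [hX]
    have := mul_le_mul_of_nonneg_left hc (by positivity : (0:ℝ) ≤ π * Real.exp (2 * v))
    nlinarith [this]
  gcongr


/-- `d/dt e^{-Xt²} = -2Xt e^{-Xt²}`. [folklore] -/
private theorem hasDerivAt_negGauss (X t : ℝ) :
    HasDerivAt (fun y : ℝ => Real.exp (-(X * y ^ 2))) (-(2 * X * t) * Real.exp (-(X * t ^ 2))) t := by
  have h1 : HasDerivAt (fun y : ℝ => -X * y ^ 2) (-X * (2 * t ^ 1)) t :=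
    (hasDerivAt_pow 2 t).const_mul (-X)
  have h2 := h1.exp
  simp only [neg_mul] at h2
  convert h2 using 1
  ring

/-- `d/dt (e^{-Xt²}/(-2X)) = t e^{-Xt²}`. [folklore] -/
private theorem hasDerivAt_primitive {X : ℝ} (hX : 0 < X) (t : ℝ) :
    HasDerivAt (fun y : ℝ => Real.exp (-(X * y ^ 2)) / (-(2 * X))) (t * Real.exp (-(X * t ^ 2))) t := by
  have h := (hasDerivAt_negGauss X t).div_const (-(2 * X))
  refine h.congr_deriv ?_
  rw [div_eq_iff (by linarith : -(2 * X) ≠ 0)]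
  ring

/-- `e^{-Xt²}/(-2X) → 0` as `t → ∞` (`X > 0`). [folklore] -/
private theorem tendsto_primitive {X : ℝ} (hX : 0 < X) :
    Tendsto (fun y : ℝ => Real.exp (-(X * y ^ 2)) / (-(2 * X))) atTop (𝓝 (0 / (-(2 * X)))) := by
  refine Tendsto.div_const ?_ _
  exact Real.tendsto_exp_atBot.comp
    (tendsto_neg_atTop_atBot.comp (Tendsto.const_mul_atTop hX (tendsto_pow_atTop two_ne_zero)))

/-- `∫_m^∞ t e^{-Xt²} dt = e^{-Xm²}/(2X)` (`X > 0`, `m ≥ 0`). [folklore] -/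
private theorem integral_Ioi_mul_exp_neg_mul_sq {X m : ℝ} (hX : 0 < X) (hm : 0 ≤ m) :
    ∫ t in Ioi m, t * Real.exp (-(X * t ^ 2)) = Real.exp (-(X * m ^ 2)) / (2 * X) := by
  have hpos : ∀ t ∈ Ioi m, 0 ≤ t * Real.exp (-(X * t ^ 2)) := fun t ht =>
    mul_nonneg (hm.trans (le_of_lt ht)) (Real.exp_pos _).le
  rw [integral_Ioi_of_hasDerivAt_of_nonneg' (fun t _ => hasDerivAt_primitive hX t) hpos
    (tendsto_primitive hX)]
  field_simp
  ring

/-- `t ↦ t e^{-Xt²}` is integrable on `(m, ∞)` (`X > 0`, `m ≥ 0`). [folklore] -/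
private theorem integrableOn_mul_exp_neg_mul_sq {X m : ℝ} (hX : 0 < X) (hm : 0 ≤ m) :
    IntegrableOn (fun t : ℝ => t * Real.exp (-(X * t ^ 2))) (Ioi m) :=
  integrableOn_Ioi_deriv_of_nonneg' (fun t _ => hasDerivAt_primitive hX t)
    (fun _ ht => mul_nonneg (hm.trans (le_of_lt ht)) (Real.exp_pos _).le) (tendsto_primitive hX)

/-- `t ↦ t e^{-Xt²}` is decreasing on `[m, ∞)` once `2Xm² ≥ 1` (`m ≥ 0`). [folklore] -/
private theorem antitoneOn_mul_exp_neg_mul_sq {X m : ℝ} (hm : 0 ≤ m) (h1 : 1 ≤ 2 * X * m ^ 2) :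
    AntitoneOn (fun t : ℝ => t * Real.exp (-(X * t ^ 2))) (Ici m) := by
  have hderiv : ∀ t : ℝ, HasDerivAt (fun t : ℝ => t * Real.exp (-(X * t ^ 2)))
      (Real.exp (-(X * t ^ 2)) * (1 - 2 * X * t ^ 2)) t := by
    intro t
    have h2 : HasDerivAt (fun y : ℝ => y * Real.exp (-(X * y ^ 2)))
        (1 * Real.exp (-(X * t ^ 2)) + t * (-(2 * X * t) * Real.exp (-(X * t ^ 2)))) t :=
      (hasDerivAt_id' t).mul (hasDerivAt_negGauss X t)
    exact h2.congr_deriv (by ring)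
  refine antitoneOn_of_hasDerivWithinAt_nonpos (convex_Ici m)
    (fun t _ => (hderiv t).continuousAt.continuousWithinAt)
    (fun t _ => (hderiv t).hasDerivWithinAt) ?_
  intro t ht
  rw [interior_Ici] at ht
  have hmt : m ^ 2 ≤ t ^ 2 := by
    have := le_of_lt (mem_Ioi.mp ht)
    nlinarith
  have h2X : 0 ≤ 2 * X := by nlinarith [sq_nonneg m]
  have : 1 ≤ 2 * X * t ^ 2 := h1.trans (by nlinarith)
  exact mul_nonpos_of_nonneg_of_nonpos (Real.exp_pos _).le (by linarith)

/-- The Gaussian tail over the integers `n > M`: `Σ_{n>M} n e^{-Xn²} ≤ e^{-XM²}/(2X)` when `2XM² ≥ 1`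
(sum of a decreasing function bounded by the integral from `M`). [folklore] -/
private theorem tsum_nat_mul_exp_le {X : ℝ} (hX : 0 < X) {M : ℕ} (h1 : 1 ≤ 2 * X * (M : ℝ) ^ 2) :
    Summable (fun i : ℕ => ((M + 1 + i : ℕ) : ℝ) * Real.exp (-(X * ((M + 1 + i : ℕ) : ℝ) ^ 2))) ∧
      ∑' i : ℕ, ((M + 1 + i : ℕ) : ℝ) * Real.exp (-(X * ((M + 1 + i : ℕ) : ℝ) ^ 2)) ≤
        Real.exp (-(X * (M : ℝ) ^ 2)) / (2 * X) := by
  set f : ℝ → ℝ := fun t => t * Real.exp (-(X * t ^ 2)) with hf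
  have hM0 : (0 : ℝ) ≤ M := Nat.cast_nonneg M
  have hanti := antitoneOn_mul_exp_neg_mul_sq hM0 h1
  have hint := integral_Ioi_mul_exp_neg_mul_sq hX hM0
  have hInt := integrableOn_mul_exp_neg_mul_sq hX hM0
  have hnonneg : ∀ t, 0 ≤ t → 0 ≤ f t := fun t ht => mul_nonneg ht (Real.exp_pos _).le
  -- partial sums ≤ the integral
  have hpartial : ∀ n : ℕ, ∑ i ∈ Finset.range n, f ((M : ℝ) + ((i + 1 : ℕ) : ℝ)) ≤
      Real.exp (-(X * (M : ℝ) ^ 2)) / (2 * X) := by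
    intro n
    have hsum := AntitoneOn.sum_le_integral (x₀ := (M : ℝ)) (a := n) (f := f)
      (hanti.mono Icc_subset_Ici_self)
    refine hsum.trans ?_
    rw [intervalIntegral.integral_of_le (le_add_of_nonneg_right (Nat.cast_nonneg n)), ← hint]
    refine setIntegral_mono_set hInt ?_ Ioc_subset_Ioi_self.eventuallyLE
    exact (ae_restrict_iff' measurableSet_Ioi).mpr
      (Eventually.of_forall fun t ht => hnonneg t (hM0.trans (le_of_lt ht)))
  have hterm : ∀ i : ℕ, ((M + 1 + i : ℕ) : ℝ) * Real.exp (-(X * ((M + 1 + i : ℕ) : ℝ) ^ 2)) =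
      f ((M : ℝ) + ((i + 1 : ℕ) : ℝ)) := by
    intro i; simp only [hf]; push_cast; ring_nf
  simp_rw [hterm]
  have hnn : ∀ i : ℕ, 0 ≤ f ((M : ℝ) + ((i + 1 : ℕ) : ℝ)) := fun i => hnonneg _ (by positivity)
  exact ⟨summable_of_sum_range_le hnn hpartial, Real.tsum_le_of_sum_range_le hnn hpartial⟩


/-- The tail with the parity power: for `a ≤ 1`, `M ≥ 1`, `2XM² ≥ 1`,
`Σ_{n>M} n^a e^{-Xn²} ≤ e^{-XM²}/(2X M^{1-a})` (from `n^a ≤ n/M^{1-a}` for `n > M`). [folklore] -/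
private theorem tsum_nat_pow_mul_exp_le {a : ℕ} (ha : a ≤ 1) {M : ℕ} (hM : 0 < M) {X : ℝ} (hX : 0 < X)
    (h1 : 1 ≤ 2 * X * (M : ℝ) ^ 2) :
    Summable (fun i : ℕ => ((M + 1 + i : ℕ) : ℝ) ^ a * Real.exp (-(X * ((M + 1 + i : ℕ) : ℝ) ^ 2))) ∧
      ∑' i : ℕ, ((M + 1 + i : ℕ) : ℝ) ^ a * Real.exp (-(X * ((M + 1 + i : ℕ) : ℝ) ^ 2)) ≤
        Real.exp (-(X * (M : ℝ) ^ 2)) / (2 * X * (M : ℝ) ^ (1 - a)) := by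
  obtain ⟨hs, hle⟩ := tsum_nat_mul_exp_le hX h1
  have hM0 : (0 : ℝ) < M := by exact_mod_cast hM
  have hterm : ∀ i : ℕ, ((M + 1 + i : ℕ) : ℝ) ^ a * Real.exp (-(X * ((M + 1 + i : ℕ) : ℝ) ^ 2)) ≤
      (1 / (M : ℝ) ^ (1 - a)) *
        (((M + 1 + i : ℕ) : ℝ) * Real.exp (-(X * ((M + 1 + i : ℕ) : ℝ) ^ 2))) := by
    intro i
    have hMn : (M : ℝ) ≤ ((M + 1 + i : ℕ) : ℝ) := by exact_mod_cast (by omega : M ≤ M + 1 + i)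
    have hpow : ((M + 1 + i : ℕ) : ℝ) ^ a * (M : ℝ) ^ (1 - a) ≤ ((M + 1 + i : ℕ) : ℝ) := by
      calc ((M + 1 + i : ℕ) : ℝ) ^ a * (M : ℝ) ^ (1 - a)
          ≤ ((M + 1 + i : ℕ) : ℝ) ^ a * ((M + 1 + i : ℕ) : ℝ) ^ (1 - a) := by
            gcongr
        _ = ((M + 1 + i : ℕ) : ℝ) := by rw [← pow_add, show a + (1 - a) = 1 by omega, pow_one]
    rw [one_div, inv_mul_eq_div, le_div_iff₀ (by positivity), mul_right_comm]
    exact mul_le_mul_of_nonneg_right hpow (Real.exp_pos _).le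
  have hnn : ∀ i : ℕ, 0 ≤ ((M + 1 + i : ℕ) : ℝ) ^ a * Real.exp (-(X * ((M + 1 + i : ℕ) : ℝ) ^ 2)) :=
    fun i => by positivity
  have hs' := (hs.mul_left (1 / (M : ℝ) ^ (1 - a)))
  refine ⟨hs'.of_nonneg_of_le hnn hterm, ?_⟩
  calc ∑' i : ℕ, ((M + 1 + i : ℕ) : ℝ) ^ a * Real.exp (-(X * ((M + 1 + i : ℕ) : ℝ) ^ 2))
      ≤ ∑' i : ℕ, (1 / (M : ℝ) ^ (1 - a)) *
          (((M + 1 + i : ℕ) : ℝ) * Real.exp (-(X * ((M + 1 + i : ℕ) : ℝ) ^ 2))) :=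
        (hs'.of_nonneg_of_le hnn hterm).tsum_le_tsum hterm hs'
    _ = (1 / (M : ℝ) ^ (1 - a)) *
          ∑' i : ℕ, ((M + 1 + i : ℕ) : ℝ) * Real.exp (-(X * ((M + 1 + i : ℕ) : ℝ) ^ 2)) :=
        tsum_mul_left
    _ ≤ (1 / (M : ℝ) ^ (1 - a)) * (Real.exp (-(X * (M : ℝ) ^ 2)) / (2 * X)) := by gcongr
    _ = Real.exp (-(X * (M : ℝ) ^ 2)) / (2 * X * (M : ℝ) ^ (1 - a)) := by
        field_simp

/-- The modulus of Booker's `r = 1` kernel at the `n`-th sample point: with `ρ = e^x/√N` and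
`v = x + log(n/√N)`, `e^{(1/2+a)v} = √ρ ρ^a · √n n^a` and `e^{2v} = ρ² n²`. [folklore] -/
private theorem exp_factors {x N n : ℝ} (hN : 0 < N) (hn : 0 < n) (a : ℕ) :
    Real.exp ((1 / 2 + (a : ℝ)) * (x + Real.log (n / Real.sqrt N))) =
        Real.sqrt (Real.exp x / Real.sqrt N) * (Real.exp x / Real.sqrt N) ^ a * (Real.sqrt n * n ^ a) ∧
      Real.exp (2 * (x + Real.log (n / Real.sqrt N))) = (Real.exp x / Real.sqrt N) ^ 2 * n ^ 2 := by
  have hv : Real.exp (x + Real.log (n / Real.sqrt N)) = Real.exp x / Real.sqrt N * n := by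
    rw [Real.exp_add, Real.exp_log (by positivity)]; ring
  constructor
  · rw [add_mul, Real.exp_add, one_div_mul_eq_div, Real.exp_half, Real.exp_nat_mul, hv,
      Real.sqrt_mul' _ hn.le, mul_pow]
    ring
  · rw [show (2 : ℝ) * (x + Real.log (n / Real.sqrt N)) = ((2 : ℕ) : ℝ) * (x + Real.log (n / Real.sqrt N))
      by norm_num, Real.exp_nat_mul, hv, mul_pow]


/-- **The tail of the theta series, sharp form (engine of Lemma 5.4 for `r = 1`, `α = 0`):** for
`|a_n| ≤ C`, `a ∈ {0,1}`, `ρ = e^x/√N`, `X = πδe^{-δ}ρ²`, `2XM² ≥ 1`: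
`|Σ_{n>M} (a_n/√n) G(x + log(n/√N))| ≤ C ρ^{1/2+a} M^{1+a} e^{-XM²}/(XM²)`
(termwise `|G| ≤ 2e^{(1/2+a)v}e^{-Xn²}` and `Σ_{n>M} n^a e^{-Xn²} ≤ e^{-XM²}/(2XM^{1-a})` — Booker's proof
of Lemma 5.4: "the terms are monotonically decreasing; thus we can estimate by the integral").
[cite: Booker2006, §5.3 Lemma 5.4 p. 401 (r = 1, α = 0) and proof] -/
theorem tail_norm_le {a : ℕ} (ha : a ≤ 1) {η : ℝ} (hη : |η| < 1) {N : ℝ} (hN : 0 < N)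
    (coef : ℕ → ℂ) {C : ℝ} (hC : ∀ n, 1 ≤ n → ‖coef n‖ ≤ C) (x : ℝ) {δ X : ℝ}
    (hδ : δ = π / 2 * (1 - |η|)) (hX : X = π * δ * Real.exp (-δ) * (Real.exp x / Real.sqrt N) ^ 2)
    {M : ℕ} (hM : 0 < M) (h1 : 1 ≤ 2 * X * (M : ℝ) ^ 2) (G : ℝ → ℂ)
    (hG : ∀ v : ℝ, G v = 2 * cexp ((1 / 2 + (a : ℂ)) * (v + π * η * I / 4)) *
      cexp (-(π * cexp (2 * (v + π * η * I / 4))))) :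
    Summable (fun i : ℕ => coef (M + 1 + i) / (Real.sqrt ((M + 1 + i : ℕ) : ℝ) : ℂ) *
        G (x + Real.log (((M + 1 + i : ℕ) : ℝ) / Real.sqrt N))) ∧
      ‖∑' i : ℕ, coef (M + 1 + i) / (Real.sqrt ((M + 1 + i : ℕ) : ℝ) : ℂ) *
          G (x + Real.log (((M + 1 + i : ℕ) : ℝ) / Real.sqrt N))‖ ≤
        C * (Real.exp x / Real.sqrt N) ^ ((1 : ℝ) / 2 + a) *
          ((M : ℝ) ^ (1 + a) * Real.exp (-(X * (M : ℝ) ^ 2)) / (X * (M : ℝ) ^ 2)) := by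
  have hδ0 := delta_pos hη hδ
  set ρ : ℝ := Real.exp x / Real.sqrt N with hρ
  have hρ0 : 0 < ρ := by positivity
  have hX0 : 0 < X := by rw [hX]; positivity
  have hC0 : 0 ≤ C := (norm_nonneg _).trans (hC 1 le_rfl)
  have hM0 : (0 : ℝ) < M := by exact_mod_cast hM
  obtain ⟨hgs, hgle⟩ := tsum_nat_pow_mul_exp_le ha hM hX0 h1
  -- termwise bound
  have hbound : ∀ i : ℕ,
      ‖coef (M + 1 + i) / (Real.sqrt ((M + 1 + i : ℕ) : ℝ) : ℂ) *
          G (x + Real.log (((M + 1 + i : ℕ) : ℝ) / Real.sqrt N))‖ ≤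
        (2 * C * (Real.sqrt ρ * ρ ^ a)) *
          (((M + 1 + i : ℕ) : ℝ) ^ a * Real.exp (-(X * ((M + 1 + i : ℕ) : ℝ) ^ 2))) := by
    intro i
    have hn0 : (0 : ℝ) < ((M + 1 + i : ℕ) : ℝ) := by positivity
    have hsq0 : 0 < Real.sqrt ((M + 1 + i : ℕ) : ℝ) := Real.sqrt_pos.mpr hn0
    obtain ⟨hE1, hE2⟩ := exp_factors (x := x) hN hn0 a
    have hGle := norm_G_le (a := (a : ℝ)) (v := x + Real.log (((M + 1 + i : ℕ) : ℝ) / Real.sqrt N))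
      hη hδ rfl
    rw [hE1, hE2] at hGle
    rw [norm_mul, norm_div, Complex.norm_real, Real.norm_of_nonneg hsq0.le, hG]
    have hcoef : ‖coef (M + 1 + i)‖ ≤ C := hC _ (by omega)
    have hXn : π * δ * Real.exp (-δ) * ((Real.exp x / Real.sqrt N) ^ 2 * ((M + 1 + i : ℕ) : ℝ) ^ 2) =
        X * ((M + 1 + i : ℕ) : ℝ) ^ 2 := by rw [hX]; ring
    rw [hXn] at hGle
    calc ‖coef (M + 1 + i)‖ / Real.sqrt ((M + 1 + i : ℕ) : ℝ) *
          ‖(2 : ℂ) * cexp ((1 / 2 + ((a : ℝ) : ℂ)) *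
              ((x + Real.log (((M + 1 + i : ℕ) : ℝ) / Real.sqrt N) : ℝ) + π * η * I / 4)) *
            cexp (-(π * cexp (2 * ((x + Real.log (((M + 1 + i : ℕ) : ℝ) / Real.sqrt N) : ℝ) +
              π * η * I / 4))))‖
        ≤ C / Real.sqrt ((M + 1 + i : ℕ) : ℝ) *
            (2 * (Real.sqrt (Real.exp x / Real.sqrt N) * (Real.exp x / Real.sqrt N) ^ a *
              (Real.sqrt ((M + 1 + i : ℕ) : ℝ) * ((M + 1 + i : ℕ) : ℝ) ^ a)) *
              Real.exp (-(X * ((M + 1 + i : ℕ) : ℝ) ^ 2))) := by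
          gcongr
      _ = (2 * C * (Real.sqrt ρ * ρ ^ a)) *
          (((M + 1 + i : ℕ) : ℝ) ^ a * Real.exp (-(X * ((M + 1 + i : ℕ) : ℝ) ^ 2))) := by
          rw [hρ]; field_simp
  have hmaj := hgs.mul_left (2 * C * (Real.sqrt ρ * ρ ^ a))
  refine ⟨Summable.of_norm_bounded hmaj hbound, ?_⟩
  calc ‖∑' i : ℕ, coef (M + 1 + i) / (Real.sqrt ((M + 1 + i : ℕ) : ℝ) : ℂ) *
          G (x + Real.log (((M + 1 + i : ℕ) : ℝ) / Real.sqrt N))‖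
      ≤ ∑' i : ℕ, (2 * C * (Real.sqrt ρ * ρ ^ a)) *
          (((M + 1 + i : ℕ) : ℝ) ^ a * Real.exp (-(X * ((M + 1 + i : ℕ) : ℝ) ^ 2))) :=
        tsum_of_norm_bounded hmaj.hasSum hbound
    _ = (2 * C * (Real.sqrt ρ * ρ ^ a)) *
          ∑' i : ℕ, ((M + 1 + i : ℕ) : ℝ) ^ a * Real.exp (-(X * ((M + 1 + i : ℕ) : ℝ) ^ 2)) :=
        tsum_mul_left
    _ ≤ (2 * C * (Real.sqrt ρ * ρ ^ a)) * (Real.exp (-(X * (M : ℝ) ^ 2)) / (2 * X * (M : ℝ) ^ (1 - a))) := by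
        gcongr
    _ = C * ρ ^ ((1 : ℝ) / 2 + a) *
          ((M : ℝ) ^ (1 + a) * Real.exp (-(X * (M : ℝ) ^ 2)) / (X * (M : ℝ) ^ 2)) := by
        rw [Real.rpow_add hρ0, Real.rpow_natCast, ← Real.sqrt_eq_rpow]
        interval_cases a
        · field_simp
          norm_num
        · field_simp
          norm_num

end ThetaTruncation

open ThetaTruncation

/-- **Booker 2006, Lemma 5.2 (journal numbering, p. 401), degree one.** Booker (Experiment. Math. 15
(2006), §5.3 "Asymptotics", Lemma 5.2 = arXiv:math/0507502 Lemma 10; called "Lemma 5.4" /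
`booker2006_lemma54_degreeOne` in this file's first version — see NUMBERING in the module docstring):
"Let `δ = (π/2)(1-|η|)`, `ν_j = (Re(μ_j)-1)/2 + 1/(2r)`,
`μ = -1/2 + (1/r)(1 + Σ μ_j)`, `K = 2√((2^{r+1}/r) e^{δ(r-1)}/δ) e^{-(πrη/4) Im(μ)}`, and
`X = π r δ e^{-δ} e^{2u/r}`. Then for `X ≥ r`,
`|G(u; η, {μ_j})| ≤ K e^{Re(μ)u} e^{-X} ∏_{j=1}^r (1 + rν_j/X)^{ν_j}`", where
`G(u; η, {μ_j}) := (1/2πi) ∫_{Re s = 2} e^{(u + iπrη/4)(1/2-s)} ∏_j Γ_ℝ(s+μ_j) ds`,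
`Γ_ℝ(s) = π^{-s/2}Γ(s/2)` (§5.1). HERE `r = 1` with one real parameter `μ₁ = a ≥ 0` (Dirichlet
`L`-functions: `a ∈ {0,1}`; `N = q`): then `ν₁ = a/2`, `μ = 1/2 + a`, `K = 4/√δ`, `X = πδe^{-δ}e^{2u}`,
and `G` is the closed form `G(u) = 2 e^{(1/2+a)(u+iπη/4)} exp(-π e^{2(u+iπη/4)})` (§5.3, on the
stationary-phase asymptotic displayed before Lemma 5.2: "For `r = 1` the formula is exact"; it is the
Cahen–Mellin integral, and the kernel of the `n`-th term of Platt's theta series, `platt2016_lemma71_72`). The conclusion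
reads `|G(u)| ≤ K e^{(1/2+a)u} e^{-X} (1 + a/(2X))^{a/2}`; in fact `|G(u)| = 2e^{(1/2+a)u}
exp(-πe^{2u}cos(πη/2)) ≤ 2 e^{(1/2+a)u} e^{-X}` (`ThetaTruncation.norm_G_le`, since
`cos(πη/2) = sin δ ≥ δe^{-δ}`), and the printed hypothesis `X ≥ r` is not needed for `r = 1` (kept as
a binder). General degree `r` is not typed. [cite: Booker2006, §5.3 Lemma 5.2 p. 401] -/
theorem booker2006_lemma52_degreeOne {a : ℝ} (ha : 0 ≤ a) {η : ℝ} (hη : |η| < 1) (u : ℝ)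
    {δ K X : ℝ} (hδ : δ = π / 2 * (1 - |η|)) (hK : K = 4 / Real.sqrt δ)
    (hX : X = π * δ * Real.exp (-δ) * Real.exp (2 * u)) (_hXr : 1 ≤ X) :
    ‖(2 : ℂ) * cexp ((1 / 2 + a) * (u + π * η * I / 4)) * cexp (-(π * cexp (2 * (u + π * η * I / 4))))‖
      ≤ K * Real.exp ((1 / 2 + a) * u) * Real.exp (-X) * (1 + a / (2 * X)) ^ (a / 2) := by
  have hδ0 := delta_pos hη hδ
  have hX0 : 0 < X := by rw [hX]; positivity
  have hK2 : 2 ≤ K := by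
    rw [hK, le_div_iff₀ (Real.sqrt_pos.mpr hδ0)]
    have : Real.sqrt δ < 2 := by
      rw [Real.sqrt_lt' (by norm_num : (0:ℝ) < 2)]
      linarith [delta_le hδ, Real.pi_lt_four]
    linarith
  have hP : 1 ≤ (1 + a / (2 * X)) ^ (a / 2) := Real.one_le_rpow (by
    have : 0 ≤ a / (2 * X) := by positivity
    linarith) (by positivity)
  calc _ ≤ 2 * Real.exp ((1 / 2 + a) * u) * Real.exp (-X) := norm_G_le hη hδ hX
    _ = 2 * Real.exp ((1 / 2 + a) * u) * Real.exp (-X) * 1 := (mul_one _).symm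
    _ ≤ K * Real.exp ((1 / 2 + a) * u) * Real.exp (-X) * (1 + a / (2 * X)) ^ (a / 2) := by
        gcongr

/-- **Booker 2006, Lemma 5.4 (journal numbering, p. 401), degree one** (the truncation error of the
coefficient series for `F̂` — the lemma Platt 2016 p. 3018 cites as "Lemma 5.4 of [3]"). Booker (§5.3,
Lemma 5.4 = arXiv Lemma 11; called "Lemma 5.5" / `booker2006_lemma55_degreeOne` in this file's first
version — see NUMBERING in the module docstring): "Let `M` be a positive integer, `x ∈ ℝ`. Let
`δ, ν_j, μ, K` be as in Lemma 5.2 and set `X = π r δ e^{-δ} (e^x/√N)^{2/r}`. Let `C, α ≥ 0` be such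
that `|a_n| ≤ C n^α` for all `n`, and put `c = Re(μ) + 1/2 + α`, `c' = max(cr/2 - 1, 0)`. Then for
`XM^{2/r} > max(c', r)`,
`|Σ_{n>M} (a_n/√n) G(x + log(n/√N); η, {μ_j})| ≤ (Kr/2) (e^x/√N)^{Re(μ)} · C M^c e^{-XM^{2/r}}/(XM^{2/r} - c') · ∏_j (1 + rν_j/(XM^{2/r}))^{ν_j}`."
(The series is the coefficient expansion `F̂(x) = ε Σ_n (a_n/√n) G(x + log(n/√N))` of §5.1, entire case,
`L(s) = Σ a_n n^{-s}`.) HERE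
`r = 1`, `μ₁ = a ∈ {0, 1}`, and `α = 0` (bounded coefficients `|a_n| ≤ C`, the case of Dirichlet
characters with `C = 1` — Remark 5.5 (p. 401) after the lemma: "for small `M`, one can take `C = 1`,
`α = log₂ r + θ`"): `Re μ = 1/2 + a`, `c = 1 + a`, `c' = 0`, the hypothesis is `XM² > 1`, and the
bound reads `(K/2)(e^x/√N)^{1/2+a} · C M^{1+a} e^{-XM²}/(XM²) · (1 + a/(2XM²))^{a/2}` with `K = 4/√δ`,
`G` the closed form of `booker2006_lemma52_degreeOne`, `N > 0` real. The sum over `n > M` is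
`Σ'_{i ≥ 0}` at `n = M + 1 + i`; its convergence is part of the conclusion. Proved via the sharper
`ThetaTruncation.tail_norm_le` (the same bound without the factor `(K/2)(1 + a/(2XM²))^{a/2} ≥ 1`).
`-- TODO(general form): |a_n| ≤ C n^α with α > 0 and general degree r are not typed.`
[cite: Booker2006, §5.3 Lemma 5.4 p. 401] -/
theorem booker2006_lemma54_degreeOne {a : ℕ} (ha : a ≤ 1) {η : ℝ} (hη : |η| < 1) {N : ℝ}
    (hN : 0 < N) (coef : ℕ → ℂ) {C : ℝ} (hC : ∀ n, 1 ≤ n → ‖coef n‖ ≤ C) (x : ℝ) {δ K X : ℝ}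
    (hδ : δ = π / 2 * (1 - |η|)) (hK : K = 4 / Real.sqrt δ)
    (hX : X = π * δ * Real.exp (-δ) * (Real.exp x / Real.sqrt N) ^ 2)
    {M : ℕ} (hM : 0 < M) (hXM : 1 < X * (M : ℝ) ^ 2) (G : ℝ → ℂ)
    (hG : ∀ v : ℝ, G v = 2 * cexp ((1 / 2 + (a : ℂ)) * (v + π * η * I / 4)) *
      cexp (-(π * cexp (2 * (v + π * η * I / 4))))) :
    Summable (fun i : ℕ => coef (M + 1 + i) / (Real.sqrt ((M + 1 + i : ℕ) : ℝ) : ℂ) *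
        G (x + Real.log (((M + 1 + i : ℕ) : ℝ) / Real.sqrt N))) ∧
      ‖∑' i : ℕ, coef (M + 1 + i) / (Real.sqrt ((M + 1 + i : ℕ) : ℝ) : ℂ) *
          G (x + Real.log (((M + 1 + i : ℕ) : ℝ) / Real.sqrt N))‖ ≤
        K / 2 * (Real.exp x / Real.sqrt N) ^ ((1 : ℝ) / 2 + a) *
          (C * (M : ℝ) ^ (1 + a) * Real.exp (-(X * (M : ℝ) ^ 2)) / (X * (M : ℝ) ^ 2)) *
          (1 + (a : ℝ) / 2 / (X * (M : ℝ) ^ 2)) ^ ((a : ℝ) / 2) := by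
  have hδ0 := delta_pos hη hδ
  have hX0 : 0 < X := by rw [hX]; positivity
  have hC0 : 0 ≤ C := (norm_nonneg _).trans (hC 1 le_rfl)
  have h1 : 1 ≤ 2 * X * (M : ℝ) ^ 2 := by linarith
  obtain ⟨hs, hle⟩ := tail_norm_le ha hη hN coef hC x hδ hX hM h1 G hG
  refine ⟨hs, hle.trans ?_⟩
  have hK2 : 1 ≤ K / 2 := by
    rw [hK, le_div_iff₀ (by norm_num : (0:ℝ) < 2), one_mul, le_div_iff₀ (Real.sqrt_pos.mpr hδ0)]
    have : Real.sqrt δ < 2 := by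
      rw [Real.sqrt_lt' (by norm_num : (0:ℝ) < 2)]
      linarith [delta_le hδ, Real.pi_lt_four]
    linarith
  have hP : 1 ≤ (1 + (a : ℝ) / 2 / (X * (M : ℝ) ^ 2)) ^ ((a : ℝ) / 2) := Real.one_le_rpow (by
    have : 0 ≤ (a : ℝ) / 2 / (X * (M : ℝ) ^ 2) := by positivity
    linarith) (by positivity)
  have hB : 0 ≤ (Real.exp x / Real.sqrt N) ^ ((1 : ℝ) / 2 + a) *
      (C * (M : ℝ) ^ (1 + a) * Real.exp (-(X * (M : ℝ) ^ 2)) / (X * (M : ℝ) ^ 2)) := by positivity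
  calc C * (Real.exp x / Real.sqrt N) ^ ((1 : ℝ) / 2 + a) *
        ((M : ℝ) ^ (1 + a) * Real.exp (-(X * (M : ℝ) ^ 2)) / (X * (M : ℝ) ^ 2))
      = 1 * ((Real.exp x / Real.sqrt N) ^ ((1 : ℝ) / 2 + a) *
          (C * (M : ℝ) ^ (1 + a) * Real.exp (-(X * (M : ℝ) ^ 2)) / (X * (M : ℝ) ^ 2))) * 1 := by ring
    _ ≤ K / 2 * ((Real.exp x / Real.sqrt N) ^ ((1 : ℝ) / 2 + a) *
          (C * (M : ℝ) ^ (1 + a) * Real.exp (-(X * (M : ℝ) ^ 2)) / (X * (M : ℝ) ^ 2))) *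
          (1 + (a : ℝ) / 2 / (X * (M : ℝ) ^ 2)) ^ ((a : ℝ) / 2) := by gcongr
    _ = _ := by ring


/-- **Platt 2016, §7.1 p. 3018 — truncating the theta series of Lemmas 7.1/7.2** ("we can now truncate
the sum, bounding the error either by reference to Lemma 5.4 of [3] or by majorising the missing terms
with the obvious geometric series"; "Lemma 5.4 of [3]" = Booker's journal Lemma 5.4, the tail lemma),
made explicit through Booker's Lemma 5.4 mechanism for `r = 1`,
`a_n = χ(n)` (`C = 1`): for `χ` primitive modulo `q > 1` with parity `a`, `|η| < 1`, `x ∈ ℝ`,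
`u = πηi/4 + x`, `δ = (π/2)(1-|η|)`, `X = πδe^{-δ}(e^x/√q)²`, and a positive integer `M` with
`2XM² ≥ 1`,
`|F̂(x) - 2ε e^{(1/2+a)u} q^{-(1/2+a)/2} Σ_{n=0}^{M} n^a χ(n) exp(-πn²e^{2u}/q)| ≤ 2|ε| e^{(1/2+a)x} q^{-(1/2+a)/2} · e^{-XM²}/(2X M^{1-a})`
(`F̂(x) = (1/2π)∫ F(t)e^{-ixt} dt` written out as in `platt2016_lemma71_72`; the `n = 0` term is `0`).
The right-hand side equals `|ε|(e^x/√q)^{1/2+a} M^{1+a}e^{-XM²}/(XM²)`, Booker's Lemma 5.4 bound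
(`booker2006_lemma54_degreeOne`, `N = q`, `C = 1`) without its factor `(K/2)(1+a/(2XM²))^{a/2} ≥ 1`.
[cite: Platt2016GRH, §7.1 p. 3018 (after Lemma 7.2); Booker2006, §5.3 Lemma 5.4 p. 401] -/
theorem platt2016_theta_truncation {q : ℕ} [NeZero q] (hq : 1 < q) {χ : DirichletCharacter ℂ q}
    (hχ : χ.IsPrimitive) (ε : ℂ) {η : ℝ} (hη : |η| < 1) (x : ℝ) {δ X : ℝ}
    (hδ : δ = π / 2 * (1 - |η|))
    (hX : X = π * δ * Real.exp (-δ) * (Real.exp x / Real.sqrt q) ^ 2)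
    {M : ℕ} (hM : 0 < M) (h1 : 1 ≤ 2 * X * (M : ℝ) ^ 2) :
    ‖(1 / (2 * π) * ∫ t : ℝ, ε * (q : ℂ) ^ (I * t / 2) * (π : ℂ) ^ (-(1 / 2 + charParity χ + I * t) / 2) *
          Complex.Gamma ((1 / 2 + charParity χ + I * t) / 2) * Complex.exp (π * η * t / 4) *
          χ.LFunction (1 / 2 + I * t) * Complex.exp (-I * x * t)) -
        2 * ε * Complex.exp ((1 / 2 + charParity χ) * (π * η * I / 4 + x)) *
          (q : ℂ) ^ (-((1 / 2 + charParity χ) / 2) : ℂ) *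
          ∑ n ∈ Finset.range (M + 1), (χ n * (n : ℂ) ^ charParity χ *
            Complex.exp (-(π * n ^ 2 * Complex.exp (2 * (π * η * I / 4 + x)) / q)))‖ ≤
      2 * ‖ε‖ * Real.exp ((1 / 2 + (charParity χ : ℝ)) * x) *
          (q : ℝ) ^ (-((1 / 2 + (charParity χ : ℝ)) / 2)) *
        (Real.exp (-(X * (M : ℝ) ^ 2)) / (2 * X * (M : ℝ) ^ (1 - charParity χ))) := by
  have ha : charParity χ ≤ 1 := charParity_le_one χ
  -- Lemmas 7.1/7.2: `F̂(x) = c · Σ_n T n`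
  rw [platt2016_lemma71_72 hq hχ ε hη x]
  have hδ0 := delta_pos hη hδ
  have hq0 : (0 : ℝ) < q := by positivity
  have hX0 : 0 < X := by rw [hX]; positivity
  set a : ℕ := charParity χ with ha_def
  set T : ℕ → ℂ := fun n => χ n * (n : ℂ) ^ a *
    cexp (-(π * n ^ 2 * cexp (2 * (π * η * I / 4 + x)) / q)) with hT
  set c : ℂ := 2 * ε * cexp ((1 / 2 + a) * (π * η * I / 4 + x)) *
    (q : ℂ) ^ (-((1 / 2 + a) / 2) : ℂ) with hc
  -- termwise bound `‖T n‖ ≤ n^a e^{-Xn²}`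
  have hcos := delta_mul_exp_le_cos hη hδ
  have hXq : X = π * δ * Real.exp (-δ) * Real.exp (2 * x) / q := by
    rw [hX, div_pow, Real.sq_sqrt hq0.le, show (2 : ℝ) * x = ((2 : ℕ) : ℝ) * x by norm_num,
      Real.exp_nat_mul]
    ring
  have hTn : ∀ n : ℕ, ‖T n‖ ≤ (n : ℝ) ^ a * Real.exp (-(X * (n : ℝ) ^ 2)) := by
    intro n
    have e2 : (2 : ℂ) * (π * η * I / 4 + x) = ((2 * x : ℝ) : ℂ) + ((π * η / 2 : ℝ) : ℂ) * I := by
      push_cast; ring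
    have e3 : -((π : ℂ) * (n : ℂ) ^ 2 * cexp (((2 * x : ℝ) : ℂ) + ((π * η / 2 : ℝ) : ℂ) * I) / (q : ℂ)) =
        (((-(π * (n : ℝ) ^ 2 / q)) : ℝ) : ℂ) * cexp (((2 * x : ℝ) : ℂ) + ((π * η / 2 : ℝ) : ℂ) * I) := by
      push_cast; ring
    have hre : (-((π : ℂ) * (n : ℂ) ^ 2 * cexp (2 * (π * η * I / 4 + x)) / (q : ℂ))).re =
        -(π * (n : ℝ) ^ 2 / q) * (Real.exp (2 * x) * Real.cos (π * η / 2)) := by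
      rw [e2, e3, re_ofReal_mul, Complex.exp_re]
      simp
    simp only [hT]
    rw [norm_mul, norm_mul, Complex.norm_exp, hre, norm_pow, Complex.norm_natCast]
    have hχn : ‖χ n‖ ≤ 1 := χ.norm_le_one n
    have hexp : Real.exp (-(π * (n : ℝ) ^ 2 / q) * (Real.exp (2 * x) * Real.cos (π * η / 2))) ≤
        Real.exp (-(X * (n : ℝ) ^ 2)) := by
      rw [Real.exp_le_exp, hXq]
      have key : π * δ * Real.exp (-δ) * Real.exp (2 * x) / q * (n : ℝ) ^ 2 ≤
          π * (n : ℝ) ^ 2 / q * (Real.exp (2 * x) * Real.cos (π * η / 2)) := by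
        have := mul_le_mul_of_nonneg_left hcos
          (by positivity : (0:ℝ) ≤ π * (n : ℝ) ^ 2 / q * Real.exp (2 * x))
        calc π * δ * Real.exp (-δ) * Real.exp (2 * x) / q * (n : ℝ) ^ 2
            = π * (n : ℝ) ^ 2 / q * Real.exp (2 * x) * (δ * Real.exp (-δ)) := by ring
          _ ≤ π * (n : ℝ) ^ 2 / q * Real.exp (2 * x) * Real.cos (π * η / 2) := this
          _ = _ := by ring
      linarith
    calc ‖χ n‖ * (n : ℝ) ^ a * Real.exp (-(π * (n : ℝ) ^ 2 / q) * (Real.exp (2 * x) * Real.cos (π * η / 2)))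
        ≤ 1 * (n : ℝ) ^ a * Real.exp (-(X * (n : ℝ) ^ 2)) := by gcongr
      _ = (n : ℝ) ^ a * Real.exp (-(X * (n : ℝ) ^ 2)) := by ring
  -- summability of the theta series
  have hTs : Summable T := by
    refine Summable.of_norm_bounded (g := fun n : ℕ => (n : ℝ) ^ a * Real.exp (-(X * (n : ℝ) ^ 2)))
      ?_ hTn
    refine (Real.summable_pow_mul_exp_neg_nat_mul a hX0).of_nonneg_of_le (fun n => by positivity) ?_
    intro n
    have hn2 : (n : ℝ) ≤ (n : ℝ) ^ 2 := by
      rcases Nat.eq_zero_or_pos n with h | h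
      · simp [h]
      · have : (1 : ℝ) ≤ n := by exact_mod_cast h
        nlinarith
    have : Real.exp (-(X * (n : ℝ) ^ 2)) ≤ Real.exp (-X * n) := by
      rw [Real.exp_le_exp]; nlinarith
    exact mul_le_mul_of_nonneg_left this (by positivity)
  -- the tail
  obtain ⟨hgs, hgle⟩ := tsum_nat_pow_mul_exp_le ha hM hX0 h1
  have hR : ‖∑' i : ℕ, T (i + (M + 1))‖ ≤
      Real.exp (-(X * (M : ℝ) ^ 2)) / (2 * X * (M : ℝ) ^ (1 - a)) := by
    refine (tsum_of_norm_bounded hgs.hasSum fun i => ?_).trans hgle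
    rw [show i + (M + 1) = M + 1 + i by ring]
    exact hTn _
  -- the prefactor
  have hcn : ‖c‖ = 2 * ‖ε‖ * Real.exp ((1 / 2 + (a : ℝ)) * x) * (q : ℝ) ^ (-((1 / 2 + (a : ℝ)) / 2)) := by
    have e1 : ((1 : ℂ) / 2 + (a : ℂ)) * (π * η * I / 4 + x) =
        ((((1 / 2 + (a : ℝ)) * x : ℝ)) : ℂ) + ((((1 / 2 + (a : ℝ)) * (π * η / 4) : ℝ)) : ℂ) * I := by
      push_cast; ring
    have e4 : (-(((1 : ℂ) / 2 + (a : ℂ)) / 2) : ℂ) = (((-((1 / 2 + (a : ℝ)) / 2)) : ℝ) : ℂ) := by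
      push_cast; ring
    rw [hc, norm_mul, norm_mul, norm_mul, Complex.norm_two, Complex.norm_exp, e1, e4,
      show (q : ℂ) = ((q : ℝ) : ℂ) by push_cast; rfl,
      Complex.norm_cpow_eq_rpow_re_of_pos hq0, Complex.ofReal_re]
    congr 2
    simp
  have hcpos : 0 ≤ 2 * ‖ε‖ * Real.exp ((1 / 2 + (a : ℝ)) * x) * (q : ℝ) ^ (-((1 / 2 + (a : ℝ)) / 2)) := by
    positivity
  -- splitting the series at `M`
  show ‖c * ∑' n : ℕ, T n - c * ∑ n ∈ Finset.range (M + 1), T n‖ ≤ _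
  rw [← hTs.sum_add_tsum_nat_add (M + 1),
    show c * (∑ n ∈ Finset.range (M + 1), T n + ∑' i : ℕ, T (i + (M + 1))) -
        c * ∑ n ∈ Finset.range (M + 1), T n = c * ∑' i : ℕ, T (i + (M + 1)) by ring,
    norm_mul, hcn]
  exact mul_le_mul_of_nonneg_left hR hcpos

end Literature.NumberTheory.LFunctions

end
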